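import Mathlib
import Summits.Ventures.PercRepro2.Defs
import Summits.Ventures.PercRepro2.Graph
import Summits.Ventures.PercRepro2.Harris
import Summits.Ventures.PercRepro2.Events
import Summits.Ventures.PercRepro2.Independence
import Summits.Ventures.PercRepro2.Induced
import Summits.Ventures.PercRepro2.ContractDefs
import Summits.Ventures.PercRepro2.GateDefs
import Summits.Ventures.PercRepro2.GateSplit
import Summits.Ventures.PercRepro2.HullTree
import Summits.Ventures.PercRepro2.GateFeedbackForest
import Summits.Ventures.PercRepro2.GateContract
import Summits.Ventures.PercRepro2.GateShadow
import Summits.Ventures.PercRepro2.GateSide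
import Summits.Ventures.PercRepro2.GateSep
import Summits.Ventures.PercRepro2.GateNear
import Summits.Ventures.PercRepro2.GateRestrict
import Summits.Ventures.PercRepro2.GateSepGeneral

/-!
# The separator and near-region theorems for an avoided SET `T` (blind cell PercRepro2,
mine-c g10; proofs/MINEC-FEEDBACK.md §6, §11–§12)

`GateContract.gateRow_contract_rep_iff` identifies the cleared gate expression of `G` at the avoided
set `T` with that of `G/T` (every vertex of `T` sent to `t₀ ∈ T`) at the single avoided vertex `t₀`.
Hence every single-vertex theorem of this line applies verbatim to `G/T`; this file records the
corollaries whose hypotheses are read on the contracted graph `G/T`: a cut vertex `z` of `G/T`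
separating the exit from `t₀` with every cycle of `G/T` through `z`, and the near region of `G/T`.
-/

namespace Summit.Ventures.PercRepro2

namespace GateSepSet

open scoped Classical

variable {V : Type*} {E : Type*} [Fintype E] [Fintype V]
variable {R : Type*} [Field R] [LinearOrder R] [IsStrictOrderedRing R]
variable {ends : E → Sym2 V}

/-- **Avoided set, separator on the exit side**: in `G/T` (`t₀ ∈ T`), a cut vertex `z` separates
`w` from `t₀`, the root is not beyond `z`, and every cycle of `G/T` passes through `z`; then
`(GATE A,{w})` holds at `T`. -/
theorem gateRow_general_of_sep_exit_set {p : E → R} (hp : IsProbVec p) (s : V) (T : Finset V)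
    (t₀ : V) (a b w z : V) (A : Finset V) (ht₀ : t₀ ∈ T) (hs : s ∉ T) (hw : w ∉ T)
    (hsep : w ∉ GateSide.side (Contract.contractEnds ends T t₀) z t₀)
    (hside : w ∉ GateSide.side (Contract.contractEnds ends T t₀) z s) (hwz : w ≠ z) (htz : t₀ ≠ z)
    (hF : Hull.IsForest (GateFeedback.endsF (Contract.contractEnds ends T t₀) z)) :
    Gate.GateRow p ends s T a b A {w} := by
  rw [← GateContract.gateRow_contract_rep_iff p ht₀ hs a b A hw]
  exact GateSepGeneral.gateRow_general_of_sep_exit_of_isForest_del_exit hp s t₀ a b w z A hsep hside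
    hwz htz hF

/-- **Avoided set, separator on the avoided side**: in `G/T`, a cut vertex `z` separates `t₀` from
`w`, the root is not beyond `z`, every cycle of `G/T` passes through `z`; then `(GATE A,{w})` holds
at `T`. -/
theorem gateRow_general_of_sep_avoid_set {p : E → R} (hp : IsProbVec p) (s : V) (T : Finset V)
    (t₀ : V) (a b w z : V) (A : Finset V) (ht₀ : t₀ ∈ T) (hs : s ∉ T) (hw : w ∉ T)
    (hsep : t₀ ∉ GateSide.side (Contract.contractEnds ends T t₀) z w)
    (hside : t₀ ∉ GateSide.side (Contract.contractEnds ends T t₀) z s) (htz : t₀ ≠ z) (hwz : w ≠ z)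
    (hF : Hull.IsForest (GateFeedback.endsF (Contract.contractEnds ends T t₀) z)) :
    Gate.GateRow p ends s T a b A {w} := by
  rw [← GateContract.gateRow_contract_rep_iff p ht₀ hs a b A hw]
  exact GateSepGeneral.gateRow_general_of_sep_avoid_of_isForest_del hp s t₀ a b w z A hsep hside
    htz hwz hF

/-- **Avoided set, the lattice condition of any reduced instance of `G/T`** gives the gate at `T`. -/
theorem gateRow_general_of_sep_two_set {p : E → R} (hp : IsProbVec p) (s : V) (T : Finset V)
    (t₀ : V) (a b w z₁ z₂ : V) (A : Finset V) (ht₀ : t₀ ∈ T) (hs : s ∉ T) (hw : w ∉ T)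
    (hsep₁ : w ∉ GateSide.side (Contract.contractEnds ends T t₀) z₁ t₀)
    (hside₁ : w ∉ GateSide.side (Contract.contractEnds ends T t₀) z₁ s) (hwz₁ : w ≠ z₁)
    (htz₁ : t₀ ≠ z₁) (hsep₂ : t₀ ∉ GateSide.side (Contract.contractEnds ends T t₀) z₂ z₁)
    (hside₂ : t₀ ∉ GateSide.side (Contract.contractEnds ends T t₀) z₂ s) (htz₂ : t₀ ≠ z₂)
    (hz₁z₂ : z₁ ≠ z₂)
    (h : GateSplit.MassA₂LogSupermod p (Contract.contractEnds ends T t₀) s z₂ A {z₁}) :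
    Gate.GateRow p ends s T a b A {w} := by
  rw [← GateContract.gateRow_contract_rep_iff p ht₀ hs a b A hw]
  exact GateSepGeneral.gateRow_general_of_sep_two hp s t₀ a b w z₁ z₂ A hsep₁ hside₁ hwz₁ htz₁
    hsep₂ hside₂ htz₂ hz₁z₂ h

section Near

attribute [local instance 2000] Classical.propDecidable

/-- **Avoided set, the near region of `G/T` decides**: if the edges of `G/T` inside the near region
of `(s, t₀, w)` not at `t₀` form a forest, `(GATE A,{w})` holds at `T`. -/
theorem gateRow_general_of_isForest_near_set {p : E → R} (hp : IsProbVec p) (s : V) (T : Finset V)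
    (t₀ : V) (a b w : V) (A : Finset V) (ht₀ : t₀ ∈ T) (hs : s ∉ T) (hw : w ∉ T) (hsw : s ≠ w)
    (htw : t₀ ≠ w)
    (hF : Hull.IsForest (GateFeedback.endsF (GateNear.endsR
      (GateNear.nearEdges (Contract.contractEnds ends T t₀) s t₀ w)
      (Contract.contractEnds ends T t₀)) t₀)) :
    Gate.GateRow p ends s T a b A {w} := by
  rw [← GateContract.gateRow_contract_rep_iff p ht₀ hs a b A hw]
  exact GateSepGeneral.gateRow_general_of_isForest_near hp s t₀ a b w A
    (fun h => hs (h ▸ ht₀)) hsw htw hF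

end Near

end GateSepSet

end Summit.Ventures.PercRepro2
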